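import Summits.CriticalPhenomena.PercolationContinuityZ3.Theorems.SahiAEHilbertCubeDensity
import Literature.Probability.LatticeModels.FourFunctionsInfiniteProduct

/-!
# No measurable everywhere-MTP₂ version in infinite dimensions

Support file of the Sahi cell (`prim-sahi`; literature seat gen34, evidence on `stmt-CriticalPhenomena-4575`, to be
landed by a prover/typer seat).  One theorem, no definitions, no named facts, no sorries.

Context.  On a FINITE product of (locally) finite measures on `ℝ`, a bounded density which is MTP₂ on almost every
pair has a version, equal to it a.e., which is MTP₂ at EVERY pair (`Theorems/SahiAEVersion.lean`,
`exists_mtp2_version_of_ae`; the version is an ultrafilter limit and is not shown measurable) — this is the step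
"choose a version of the density for which the inequality holds everywhere" that the literature takes as the
DEFINITION of MTP₂ (Karlin–Rinott 1980 (1.4); Müller–Stoyan 2002 (3.10.8); Fuchs–Wang 2026, p. 2).  On the Hilbert
cube the step is impossible even for a merely measurable version: the density of
`Theorems/SahiAEHilbertCubeDensity.lean` (`exists_aePair_latticeCondition_not_mIsAffiliated`: bounded, measurable,
MTP₂ on almost every pair, law not affiliated) has NO measurable version satisfying the lattice inequality at every
pair, because by the infinite-product four functions theorem (Batty–Bollmann 1980, Cor. 3.9; tree
`BattyBollmann.mIsAffiliated_withDensity_infinitePi`) the law of such a version — which is the same law — would be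
affiliated.

* `exists_aePair_latticeCondition_no_measurable_version` — **on `ℕ → [0,1]` with product Lebesgue measure `P` there
  is a measurable `f ≤ 9`, MTP₂ on `P ⊗ P`-almost every pair, whose law `f·P` is not affiliated and such that no
  measurable `g = f` `P`-a.e. satisfies `g(x) g(y) ≤ g(x ∧ y) g(x ∨ y)` for all `x, y`.** [this work]
-/

noncomputable section

namespace Summit.CriticalPhenomena.PercolationContinuityZ3.Theorems.SahiAEHilbertCubeDensity

open MeasureTheory Set unitInterval
open Literature.Probability.LatticeModels Literature.Probability.LatticeModels.Affiliation
open Literature.Probability.LatticeModels.BattyBollmann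
open scoped ENNReal

/-- **No measurable everywhere-MTP₂ version in infinite dimensions.**  On the Hilbert cube `ℕ → [0,1]` with
product Lebesgue measure `P` there is a bounded measurable density `f`, MTP₂ on `P ⊗ P`-almost every pair, whose law
is not affiliated and such that NO measurable `g` with `g = f` `P`-a.e. satisfies `g(x) g(y) ≤ g(x ∧ y) g(x ∨ y)`
for all `x, y`: otherwise the common law `g·P = f·P` (`withDensity_congr_ae`) would be affiliated by the
infinite-product four functions theorem (`BattyBollmann.mIsAffiliated_withDensity_infinitePi`,
[BattyBollmann1980, Cor. 3.9]).  Contrast: `exists_mtp2_version_of_ae` (finite products). [this work] -/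
theorem exists_aePair_latticeCondition_no_measurable_version :
    ∃ f : (ℕ → I) → ℝ≥0∞, Measurable f ∧ (∀ x, f x ≤ 9) ∧
      (∀ᵐ p ∂(Measure.infinitePi (fun _ : ℕ => (volume : Measure I))).prod
          (Measure.infinitePi (fun _ : ℕ => (volume : Measure I))),
        f p.1 * f p.2 ≤ f (p.1 ⊓ p.2) * f (p.1 ⊔ p.2)) ∧
      ¬ mIsAffiliated ((Measure.infinitePi (fun _ : ℕ => (volume : Measure I))).withDensity f) ∧
      ∀ g : (ℕ → I) → ℝ≥0∞, Measurable g →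
        g =ᵐ[Measure.infinitePi (fun _ : ℕ => (volume : Measure I))] f →
        ¬ ∀ x y, g x * g y ≤ g (x ⊓ y) * g (x ⊔ y) := by
  obtain ⟨f, hfm, hfle, hae, -, hnaff, -, -⟩ := exists_aePair_latticeCondition_not_mIsAffiliated
  refine ⟨f, hfm, hfle, hae, hnaff, fun g hgm hgf hMTP => hnaff ?_⟩
  have h := mIsAffiliated_withDensity_infinitePi (fun _ : ℕ => (volume : Measure I)) g hgm hMTP
  rwa [withDensity_congr_ae hgf] at h

end Summit.CriticalPhenomena.PercolationContinuityZ3.Theorems.SahiAEHilbertCubeDensity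

end
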